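import Mathlib
import Literature.Analysis.FluidPDE.VectorCalculus
import Summits.NavierStokesRegularity.NavierStokesRegularity.Theorems.FilamentSkeletonRssClause13RAdjointWaistSourced

/-!
# Clause 13-R, STUB R at MODEL level: the SOURCED waist law, LEFT half-ball `[σ₁, c)` (mirror of `…Clause13RAdjointWaistSourced`)
# (crux `Clause13RNearStraightL`, stmt-NavierStokesRegularity-23612; line `rate_bordered_split`, STUB R `stub_rateRow13RFlat`)

Route `FilamentSkeletonRss`, Variant A1R.  `…Clause13RAdjointWaistSourced` treats the right half-ball `(c, σ₁]` of the stagnation point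
`c` of the slip `w` (`w ≥ 0` there).  Left of the waist `w ≤ 0`, the controlled quantity is `|w|‖φ‖ = −w‖φ‖`, and the comparison function
`s ↦ √(w²‖φ‖² + ε²) + G·s` is non-DEcreasing; this file records the mirrored statements for the sourced local adjoint equation
  `w σ φ′ σ + (½ + w′ σ) φ σ + α e × φ σ + cst·m σ (φ σ × d) = g σ`:
* `sqrt_wsq_normsq_monotoneOn_left`, `wnorm_le_of_sourced_left` — `|w(σ₀)|‖φ(σ₀)‖ ≤ |w(σ₁)|‖φ(σ₁)‖ + G(σ₁ − σ₀)` for `σ₀ ≤ σ₁` in a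
  stretch where `w ≤ 0`, `‖g‖ ≤ G`;
* `wnorm_le_of_waistRegular_left` — on the punctured half-ball `[σ₁, c)` (`C¹` there only), a WAIST-REGULAR solution (`w‖φ‖ → 0` at `c⁻`)
  obeys `|w(σ)|‖φ(σ)‖ ≤ G(c − σ)`; `eq_zero_of_waistRegular_left` — for `g = 0` it vanishes wherever `w ≠ 0` (improper version of
  `…Clause13RAdjointWaistLaw.eq_zero_of_waist_left`); `wnorm_ge_of_sourced_left` — the blow-up alternative `|w(σ)|‖φ(σ)‖ ≥ |w(σ₁)|‖φ(σ₁)‖ − G(c − σ₁)`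
  going into the waist from the left.
(Uniqueness, the sup bound `‖φ‖ ≤ G/κ₁` under `|w(s)| ≥ κ₁(c − s)`, and the dichotomy follow from these verbatim as on the right.)  [folklore]
Hand `leafhand-ns-filamentskeletonrs-19-g0` (LAND-ONLY); `--supports stmt-NavierStokesRegularity-23612` helper, def-free.  HONEST FRAMING: ODE estimates
for the MODEL adjoint equation attached to a HYPOTHETICAL filament skeleton on the NEGATIVE side of a MODEL blow-up route; STUB R is NOT proved here
and nothing in this file bears on Navier–Stokes regularity or blow-up.
-/

noncomputable section

open MeasureTheory Filter Topology Set
open scoped RealInnerProductSpace InnerProductSpace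
open Literature.Analysis.FluidPDE
open Summit.NavierStokesRegularity.NavierStokesRegularity.Theorems.Clause13RAdjointWaistSourced (hasDerivAt_wsq_normsq_sourced)

namespace Summit.NavierStokesRegularity.NavierStokesRegularity.Theorems.Clause13RAdjointWaistSourcedLeft
set_option linter.dupNamespace false

/-! ## §1 The comparison function left of the waist (`w ≤ 0`) -/

/-- Key comparison function, left of the waist: for `ε > 0`, `s ↦ √(w(s)²‖φ(s)‖² + ε²) + G·s` is non-decreasing on `[σ₀, σ₁]` when
`w ≤ 0`, `‖g‖ ≤ G` and the sourced equation holds there. [folklore] -/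
theorem sqrt_wsq_normsq_monotoneOn_left {σ₀ σ₁ cst α G ε : ℝ} {m w w' : ℝ → ℝ} {φ φ' g : ℝ → EuclideanSpace ℝ (Fin 3)}
    {d e : EuclideanSpace ℝ (Fin 3)} (hε : 0 < ε)
    (hw : ∀ s ∈ Icc σ₀ σ₁, HasDerivAt w (w' s) s) (hφ : ∀ s ∈ Icc σ₀ σ₁, HasDerivAt φ (φ' s) s)
    (hwnp : ∀ s ∈ Icc σ₀ σ₁, w s ≤ 0) (hg : ∀ s ∈ Icc σ₀ σ₁, ‖g s‖ ≤ G)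
    (heq : ∀ s ∈ Icc σ₀ σ₁,
      w s • φ' s + (1 / 2 : ℝ) • φ s + w' s • φ s + α • cross e (φ s) + (cst * m s) • cross (φ s) d = g s) :
    MonotoneOn (fun s => Real.sqrt (w s ^ 2 * ‖φ s‖ ^ 2 + ε ^ 2) + G * s) (Icc σ₀ σ₁) := by
  have hcont : ContinuousOn (fun s => Real.sqrt (w s ^ 2 * ‖φ s‖ ^ 2 + ε ^ 2) + G * s) (Icc σ₀ σ₁) := by
    intro s hs
    have hwc : ContinuousAt w s := (hw s hs).continuousAt
    have hφc : ContinuousAt φ s := (hφ s hs).continuousAt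
    have h : ContinuousAt (fun s => Real.sqrt (w s ^ 2 * ‖φ s‖ ^ 2 + ε ^ 2) + G * s) s :=
      (((hwc.pow 2).mul (hφc.norm.pow 2)).add continuousAt_const).sqrt.add (continuousAt_const.mul continuousAt_id)
    exact h.continuousWithinAt
  refine monotoneOn_of_hasDerivWithinAt_nonneg (convex_Icc σ₀ σ₁) hcont
    (f' := fun s => (-(w s * ‖φ s‖ ^ 2) + 2 * w s * ⟪g s, φ s⟫) / (2 * Real.sqrt (w s ^ 2 * ‖φ s‖ ^ 2 + ε ^ 2)) + G * 1)
    ?_ ?_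
  · intro s hs
    rw [interior_Icc] at hs
    have hs' := Ioo_subset_Icc_self hs
    have hE := hasDerivAt_wsq_normsq_sourced (hw s hs') (hφ s hs') (heq s hs')
    have hpos : w s ^ 2 * ‖φ s‖ ^ 2 + ε ^ 2 ≠ 0 := by positivity
    exact (((hE.add_const (ε ^ 2)).sqrt hpos).add ((hasDerivAt_id' s).const_mul G)).hasDerivWithinAt
  · intro s hs
    rw [interior_Icc] at hs
    have hs' := Ioo_subset_Icc_self hs
    have hpos : 0 < w s ^ 2 * ‖φ s‖ ^ 2 + ε ^ 2 := by positivity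
    have hR : 0 < Real.sqrt (w s ^ 2 * ‖φ s‖ ^ 2 + ε ^ 2) := Real.sqrt_pos.mpr hpos
    have hwφ : 0 ≤ -(w s * ‖φ s‖) := by nlinarith [hwnp s hs', norm_nonneg (φ s)]
    have hwφR : -(w s * ‖φ s‖) ≤ Real.sqrt (w s ^ 2 * ‖φ s‖ ^ 2 + ε ^ 2) := by
      rw [show w s ^ 2 * ‖φ s‖ ^ 2 + ε ^ 2 = (-(w s * ‖φ s‖)) ^ 2 + ε ^ 2 by ring]
      calc -(w s * ‖φ s‖) = Real.sqrt ((-(w s * ‖φ s‖)) ^ 2) := (Real.sqrt_sq hwφ).symm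
        _ ≤ Real.sqrt ((-(w s * ‖φ s‖)) ^ 2 + ε ^ 2) := Real.sqrt_le_sqrt (by nlinarith [sq_nonneg ε])
    have hG : 0 ≤ G := (norm_nonneg _).trans (hg s hs')
    have hinner : |⟪g s, φ s⟫| ≤ G * ‖φ s‖ :=
      (abs_real_inner_le_norm _ _).trans (mul_le_mul_of_nonneg_right (hg s hs') (norm_nonneg _))
    have h1 : w s * ‖φ s‖ ^ 2 ≤ 0 := by nlinarith [hwnp s hs', sq_nonneg ‖φ s‖]
    have h2 : w s * (G * ‖φ s‖) ≤ w s * ⟪g s, φ s⟫ :=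
      mul_le_mul_of_nonpos_left ((le_abs_self _).trans hinner) (hwnp s hs')
    have h3 : G * (-(w s * ‖φ s‖)) ≤ G * Real.sqrt (w s ^ 2 * ‖φ s‖ ^ 2 + ε ^ 2) := mul_le_mul_of_nonneg_left hwφR hG
    have hnum : -(2 * G * Real.sqrt (w s ^ 2 * ‖φ s‖ ^ 2 + ε ^ 2)) ≤ -(w s * ‖φ s‖ ^ 2) + 2 * w s * ⟪g s, φ s⟫ := by
      nlinarith [h1, h2, h3]
    have hdiv : -G ≤ (-(w s * ‖φ s‖ ^ 2) + 2 * w s * ⟪g s, φ s⟫) / (2 * Real.sqrt (w s ^ 2 * ‖φ s‖ ^ 2 + ε ^ 2)) := by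
      rw [le_div_iff₀ (by positivity)]
      nlinarith [hnum]
    show 0 ≤ (-(w s * ‖φ s‖ ^ 2) + 2 * w s * ⟪g s, φ s⟫) / (2 * Real.sqrt (w s ^ 2 * ‖φ s‖ ^ 2 + ε ^ 2)) + G * 1
    linarith

/-- **SOURCED WAIST LAW, left of the waist (quantitative).**  If `φ ∈ C¹[σ₀, σ₁]` solves the sourced local adjoint equation there, with
`w ≤ 0` and `‖g‖ ≤ G` on `[σ₀, σ₁]`, then `|w(σ₀)|‖φ(σ₀)‖ ≤ |w(σ₁)|‖φ(σ₁)‖ + G·(σ₁ − σ₀)`. [folklore] -/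
theorem wnorm_le_of_sourced_left {σ₀ σ₁ cst α G : ℝ} {m w w' : ℝ → ℝ} {φ φ' g : ℝ → EuclideanSpace ℝ (Fin 3)}
    {d e : EuclideanSpace ℝ (Fin 3)} (hσ : σ₀ ≤ σ₁)
    (hw : ∀ s ∈ Icc σ₀ σ₁, HasDerivAt w (w' s) s) (hφ : ∀ s ∈ Icc σ₀ σ₁, HasDerivAt φ (φ' s) s)
    (hwnp : ∀ s ∈ Icc σ₀ σ₁, w s ≤ 0) (hg : ∀ s ∈ Icc σ₀ σ₁, ‖g s‖ ≤ G)
    (heq : ∀ s ∈ Icc σ₀ σ₁,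
      w s • φ' s + (1 / 2 : ℝ) • φ s + w' s • φ s + α • cross e (φ s) + (cst * m s) • cross (φ s) d = g s) :
    |w σ₀| * ‖φ σ₀‖ ≤ |w σ₁| * ‖φ σ₁‖ + G * (σ₁ - σ₀) := by
  rw [abs_of_nonpos (hwnp σ₀ (left_mem_Icc.2 hσ)), abs_of_nonpos (hwnp σ₁ (right_mem_Icc.2 hσ))]
  have h0 : 0 ≤ -w σ₀ * ‖φ σ₀‖ := mul_nonneg (neg_nonneg.2 (hwnp σ₀ (left_mem_Icc.2 hσ))) (norm_nonneg _)
  have h1 : 0 ≤ -w σ₁ * ‖φ σ₁‖ := mul_nonneg (neg_nonneg.2 (hwnp σ₁ (right_mem_Icc.2 hσ))) (norm_nonneg _)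
  refine le_of_forall_pos_le_add fun ε hε => ?_
  have hM := sqrt_wsq_normsq_monotoneOn_left hε hw hφ hwnp hg heq
  have hle : Real.sqrt (w σ₀ ^ 2 * ‖φ σ₀‖ ^ 2 + ε ^ 2) + G * σ₀ ≤ Real.sqrt (w σ₁ ^ 2 * ‖φ σ₁‖ ^ 2 + ε ^ 2) + G * σ₁ :=
    hM (left_mem_Icc.2 hσ) (right_mem_Icc.2 hσ) hσ
  have hlow : -w σ₀ * ‖φ σ₀‖ ≤ Real.sqrt (w σ₀ ^ 2 * ‖φ σ₀‖ ^ 2 + ε ^ 2) := by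
    rw [show w σ₀ ^ 2 * ‖φ σ₀‖ ^ 2 + ε ^ 2 = (-w σ₀ * ‖φ σ₀‖) ^ 2 + ε ^ 2 by ring]
    calc -w σ₀ * ‖φ σ₀‖ = Real.sqrt ((-w σ₀ * ‖φ σ₀‖) ^ 2) := (Real.sqrt_sq h0).symm
      _ ≤ Real.sqrt ((-w σ₀ * ‖φ σ₀‖) ^ 2 + ε ^ 2) := Real.sqrt_le_sqrt (by nlinarith [sq_nonneg ε])
  have hup : Real.sqrt (w σ₁ ^ 2 * ‖φ σ₁‖ ^ 2 + ε ^ 2) ≤ -w σ₁ * ‖φ σ₁‖ + ε :=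
    calc Real.sqrt (w σ₁ ^ 2 * ‖φ σ₁‖ ^ 2 + ε ^ 2) ≤ Real.sqrt ((-w σ₁ * ‖φ σ₁‖ + ε) ^ 2) :=
          Real.sqrt_le_sqrt (by nlinarith [mul_nonneg h1 hε.le])
      _ = -w σ₁ * ‖φ σ₁‖ + ε := Real.sqrt_sq (by linarith)
  linarith

/-! ## §2 At the waist, left half-ball `[σ₁, c)` -/

/-- **A-PRIORI BOUND for the waist-regular branch (left half-ball).**  Let `φ` solve the sourced local adjoint equation on the punctured
half-ball `[σ₁, c)` (`C¹` there only), with `w ≤ 0`, `‖g‖ ≤ G` there, and `w‖φ‖ → 0` at `c⁻`.  Then `|w(σ)|‖φ(σ)‖ ≤ G·(c − σ)` on `[σ₁, c)`.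
[folklore] -/
theorem wnorm_le_of_waistRegular_left {σ₁ c cst α G : ℝ} {m w w' : ℝ → ℝ} {φ φ' g : ℝ → EuclideanSpace ℝ (Fin 3)}
    {d e : EuclideanSpace ℝ (Fin 3)}
    (hw : ∀ s ∈ Ico σ₁ c, HasDerivAt w (w' s) s) (hφ : ∀ s ∈ Ico σ₁ c, HasDerivAt φ (φ' s) s)
    (hwnp : ∀ s ∈ Ico σ₁ c, w s ≤ 0) (hg : ∀ s ∈ Ico σ₁ c, ‖g s‖ ≤ G)
    (heq : ∀ s ∈ Ico σ₁ c,
      w s • φ' s + (1 / 2 : ℝ) • φ s + w' s • φ s + α • cross e (φ s) + (cst * m s) • cross (φ s) d = g s)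
    (hreg : Tendsto (fun s => w s * ‖φ s‖) (𝓝[<] c) (𝓝 0))
    {σ : ℝ} (hσ : σ ∈ Ico σ₁ c) : |w σ| * ‖φ σ‖ ≤ G * (c - σ) := by
  have hG : 0 ≤ G := (norm_nonneg _).trans (hg σ hσ)
  have key : ∀ s ∈ Ioo σ c, |w σ| * ‖φ σ‖ - G * (c - σ) ≤ -(w s * ‖φ s‖) := by
    intro s hs
    have hsub : Icc σ s ⊆ Ico σ₁ c := fun x hx => ⟨hσ.1.trans hx.1, hx.2.trans_lt hs.2⟩
    have h := wnorm_le_of_sourced_left hs.1.le (fun x hx => hw x (hsub hx)) (fun x hx => hφ x (hsub hx))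
      (fun x hx => hwnp x (hsub hx)) (fun x hx => hg x (hsub hx)) (fun x hx => heq x (hsub hx))
    rw [abs_of_nonpos (hwnp s (hsub (right_mem_Icc.2 hs.1.le)))] at h
    have : 0 ≤ G * (c - s) := mul_nonneg hG (sub_nonneg.2 hs.2.le)
    linarith
  have hev : ∀ᶠ s in 𝓝[<] c, |w σ| * ‖φ σ‖ - G * (c - σ) ≤ -(w s * ‖φ s‖) :=
    eventually_of_mem (Ioo_mem_nhdsLT hσ.2) key
  have hreg' : Tendsto (fun s => -(w s * ‖φ s‖)) (𝓝[<] c) (𝓝 0) := by simpa using hreg.neg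
  have h := ge_of_tendsto hreg' hev
  linarith

/-- **NO nonzero waist-regular branch of the homogeneous equation on the punctured half-ball (left)** — improper version of
`…Clause13RAdjointWaistLaw.eq_zero_of_waist_left`: a solution of the HOMOGENEOUS local adjoint equation on `[σ₁, c)`, `C¹` there only, with
`w ≤ 0` there and `w‖φ‖ → 0` at `c⁻`, vanishes at every station where `w ≠ 0`. [folklore] -/
theorem eq_zero_of_waistRegular_left {σ₁ c cst α : ℝ} {m w w' : ℝ → ℝ} {φ φ' : ℝ → EuclideanSpace ℝ (Fin 3)}
    {d e : EuclideanSpace ℝ (Fin 3)}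
    (hw : ∀ s ∈ Ico σ₁ c, HasDerivAt w (w' s) s) (hφ : ∀ s ∈ Ico σ₁ c, HasDerivAt φ (φ' s) s)
    (hwnp : ∀ s ∈ Ico σ₁ c, w s ≤ 0)
    (heq : ∀ s ∈ Ico σ₁ c,
      w s • φ' s + (1 / 2 : ℝ) • φ s + w' s • φ s + α • cross e (φ s) + (cst * m s) • cross (φ s) d = 0)
    (hreg : Tendsto (fun s => w s * ‖φ s‖) (𝓝[<] c) (𝓝 0))
    {σ : ℝ} (hσ : σ ∈ Ico σ₁ c) (hwσ : w σ ≠ 0) : φ σ = 0 := by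
  have h := wnorm_le_of_waistRegular_left (g := fun _ => 0) (G := 0) hw hφ hwnp (fun s _ => by simp)
    (fun s hs => by rw [heq s hs]) hreg hσ
  have hwpos : 0 < |w σ| := abs_pos.2 hwσ
  have hn : ‖φ σ‖ ≤ 0 := by
    by_contra hlt
    have := mul_pos hwpos (not_le.mp hlt)
    linarith
  exact norm_eq_zero.mp (le_antisymm hn (norm_nonneg _))

/-- **Lower bound going INTO the waist (left half-ball).**  For a solution on `[σ₁, c)` (`w ≤ 0`, `‖g‖ ≤ G`):
`|w(σ)|‖φ(σ)‖ ≥ |w(σ₁)|‖φ(σ₁)‖ − G(c − σ₁)` for every `σ ∈ [σ₁, c)`; a branch exceeding the regular budget at one station therefore blows up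
at least like `m/|w(σ)|` at the waist (`m > 0`), non-integrably. [folklore] -/
theorem wnorm_ge_of_sourced_left {σ₁ c cst α G : ℝ} {m w w' : ℝ → ℝ} {φ φ' g : ℝ → EuclideanSpace ℝ (Fin 3)}
    {d e : EuclideanSpace ℝ (Fin 3)}
    (hw : ∀ s ∈ Ico σ₁ c, HasDerivAt w (w' s) s) (hφ : ∀ s ∈ Ico σ₁ c, HasDerivAt φ (φ' s) s)
    (hwnp : ∀ s ∈ Ico σ₁ c, w s ≤ 0) (hg : ∀ s ∈ Ico σ₁ c, ‖g s‖ ≤ G)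
    (heq : ∀ s ∈ Ico σ₁ c,
      w s • φ' s + (1 / 2 : ℝ) • φ s + w' s • φ s + α • cross e (φ s) + (cst * m s) • cross (φ s) d = g s)
    {σ : ℝ} (hσ : σ ∈ Ico σ₁ c) : |w σ₁| * ‖φ σ₁‖ - G * (c - σ₁) ≤ |w σ| * ‖φ σ‖ := by
  have hG : 0 ≤ G := (norm_nonneg _).trans (hg σ hσ)
  have hsub : Icc σ₁ σ ⊆ Ico σ₁ c := fun x hx => ⟨hx.1, hx.2.trans_lt hσ.2⟩
  have h := wnorm_le_of_sourced_left hσ.1 (fun x hx => hw x (hsub hx)) (fun x hx => hφ x (hsub hx))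
    (fun x hx => hwnp x (hsub hx)) (fun x hx => hg x (hsub hx)) (fun x hx => heq x (hsub hx))
  have : 0 ≤ G * (c - σ) := mul_nonneg hG (sub_nonneg.2 hσ.2.le)
  linarith

end Summit.NavierStokesRegularity.NavierStokesRegularity.Theorems.Clause13RAdjointWaistSourcedLeft

end
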